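/-
COR-CM (cell pub-hodgecm2, stage 2 of the Hodge ladder) — lane V-TRANSPORT (seat b06 gen 22; count-neutral, no
BINDER-OWNERS row, no E term, no display of record; Interfaces (C1) untouched; wording of record untouched).
ROW A `TowerDominance` of the junction-B01 ideation memo IDEA-1g (b01-idea-1 gen 7, «one tower per field», route L1g-A)
PROVED on the universe of record: the hermitian space `V` is a removable binder of `PeriodNV` / `PeriodThmF` / `PerL`.
Wording of record (verbatim, unchanged by this file): HC_CM follows in the kernel from BallQuotientUniformised ∧ PerLFace(model universe of record).
T5: consistency check by b06 g22 2026-08-21T18:22Z — BY INHABITATION: the only named-fact hypothesis binders of the new theorems are the four universe-of-record records `exists_isReal_hodgeModel` / `hodgePQ_independent_of_hodgeModel` / `BallQuotientUniformised` (resp. `BallQuotientUniformisedDatum`) / `CMAbelianVarietyRealised`, all DISCHARGED tree theorems (`exists_isReal_hodgeModel_holds`, `hodgePQ_independent_of_hodgeModel_holds`, `BallQuotient.ballQuotientUniformised_holds` / `ballQuotientUniformisedDatum_of`, `cmAbelianVarietyRealised_holds`), so their conjunction is inhabited and no contradiction is derivable; the remaining binders are data and elementary side conditions (`2 < finrank ℚ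 L`, `IsGalois ℚ F`, `finrank ℚ F = 6`, a `PeriodNV`/`PerL` ANTECEDENT of the same open kind as the conclusion — transports, no supply hypothesis, no hand-summarised Literature binder) — no contradiction derived.  HC_CM is NOT proved.
CREDIT: §1 (the kernel transports `trC_pullC_of_degree`, `period_comp_of_degree`, `periodNV_of_dominant` and the two
corollaries) is ADAPTED from `HOME/b01/IDEA-1g-Sketch.lean` §2–§3 (planner-pub-hodgecm2-b01-idea-1-g7-0), same names.
-/
import Summits.HodgeConjecture.CorCM.HermSpaceTransport
import Summits.HodgeConjecture.CorCM.B01.HeckePair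
import Summits.HodgeConjecture.CorCM.Model.TopTraceUnit
import Summits.HodgeConjecture.CorCM.Model.PerLConeFacts
import Summits.HodgeConjecture.CorCM.Proofs.Prop22.Basic
import Summits.HodgeConjecture.CorCM.Proofs.Landherr
import Summits.HodgeConjecture.CorCM.Interfaces
import Literature.AlgebraicGeometry.ShimuraVarieties.UnitaryBallIsometricQuotients
import HarnessLib

/-!
# COR-CM — one tower per field: the hermitian space is a removable binder on the universe of record

For a CM field `L` with `[L:ℚ] > 2`, an embedding `ι₁`, and ANY two hermitian 3-spaces `V V' : HermSpace3 L ι₁` of PerL's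
signature, every compact Picard modular surface `P(V, Γ)` of the universe of record `U = Model.picardCMUniverse hHD hI h₁ h₃`
is the target of an ISOMORPHISM-SHAPED morphism `e : P(V', Γ') → P(V, Γ)` from a surface of the `V'`-tower
(`Γ' = Γ.transport B …`, `[v] ↦ [√ι₁(a) · B^{ι₁} v]` for Landherr's similitude `ᵗ(c̄B) · (a • V.Hm) · B = V'.Hm` of
`CorCM/HermSpaceTransport.lean`), with `e^*` bijective on every `Hᵏ` and `tr_{Γ'} ∘ e^* = d • tr_Γ`, `d ≠ 0`, on `H⁴`:

* §1 (kernel, any universe with `Fact_pull_comp`, `Fact_pull_cup`; adapted from IDEA-1g-Sketch §2–§3 with credit) —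
  `Universe.period_comp_of_degree`, `Universe.periodNV_of_dominant`: a non-zero period is transported along a morphism of
  non-zero degree;
* §2 (generic) — `Model.exists_tr_comp_pull_eq_smul`: for smooth projective surfaces, a morphism whose pull-back is injective
  on `H⁴` satisfies `tr' ∘ e^* = d • tr` with `d ≠ 0` (the light trace is the coordinate of the line `H⁴`, `finrank_rat_top`);
* §3 (scheme level, over `BallQuotientUniformisedDatum`) — `Model.ballDatum_map_Γ_conj_eq` (the groups of the two ball data
  are conjugate-EQUAL under `B^{ι₁}`), `Model.exists_hom_pms_transport` (the morphism `e` with bijective Betti pull-backs: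
  Literature `UnitaryBallIsometricQuotients.exists_hom_bettiCohomology_bijective` on the isometry `g = √ι₁(a) · B^{ι₁}`);
* §4 (the universe of record) — **`Model.towerDominance_of_two_lt`** (row A of IDEA-1g for `[L:ℚ] > 2`: `∃ Γ' e d, d ≠ 0 ∧
  tr ∘ e^* = d • tr`), **`Model.periodNV_transport`** (`PeriodNV ι₁ V K Ψ σ → PeriodNV ι₁ V' K Ψ σ`),
  **`Model.perL44_of_perL : U.PerL → U.PerL44`** (PerL Thm 4.4 "as proved", `∀ (V₃,h)`, from the node statement `W_per^L`,
  `∃ (V₃,h)`; `[L:ℚ] ∈ {24, 48}`), **`Model.periodThmF_iff_exists`** / **`Model.perLFace_iff_exists`** (the face period theorem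
  `PeriodThmF = PerLFace` of the universe of record is equivalent to its `∃ V`-form: ONE hermitian space per `(F, f, ι₁)`
  suffices; `→` by `LandherrExists`).

Why `[L:ℚ] > 2`: off the anisotropic regime (imaginary-quadratic `L`, where `(V₃,h)` of signature `(2,1)` is isotropic and
`Γ\𝔹²` is not compact) the model universe realises `pms` by the placeholder `ℙ²`; every consumer (`PeriodThmF`: `[F:ℚ] ≥ 6`;
`PerL`/`PerL44`: `[L:ℚ] ∈ {24,48}`) lives in the anisotropic regime (`isAnisotropic_pmsCode_of_two_lt`).
What this does NOT do: it creates no period — it answers ROUTES-B01 §3 R4's «∃V ⇏ ∀V» for the universe of record (there: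
∃V ⇒ ∀V), so that the open leaves B01-S / B01-O may be met on ONE convenient hermitian space per face datum.  Theorems only.
-/

noncomputable section

open scoped TensorProduct Matrix ComplexOrder
open NumberField CategoryTheory
open Literature.AlgebraicGeometry.Motives
open Literature.AlgebraicGeometry.Motives.HodgeStructure (conj ofRat)
open Literature.AlgebraicGeometry.ShimuraVarieties
open Literature.AlgebraicGeometry.HodgeTheory
open Literature.NumberTheory.Automorphic
open Literature.NumberTheory.Transcendental (arapura2012_cor_15_4_6_holds)

namespace Summit.HodgeConjecture.CorCM

/-! ### §1 Transport of the quadrilinear period along a morphism of non-zero degree (kernel; IDEA-1g-Sketch §2–§3) -/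

namespace Universe

variable {U : Universe}

/-- A degree identity `tr ∘ e^* = d • tr` on `H⁴(−, ℚ)` complexifies: `trC (e^* z) = d · trC z`.  (Adapted from
IDEA-1g-Sketch §2, b01-idea-1 gen 7.) [folklore] -/
theorem trC_pullC_of_degree {X X' : U.Var} {e : U.Mor X' X} {d : ℚ}
    (he : U.tr X' 4 ∘ₗ U.pull e 4 = d • U.tr X 4) (z : U.CohC X 4) :
    U.trC X' 4 (U.pullC e 4 z) = (d : ℂ) • U.trC X 4 z := by
  induction z using TensorProduct.induction_on with
  | zero => simp
  | add a b ha hb => simp only [map_add, ha, hb, smul_add]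
  | tmul c x =>
    have h1 : U.tr X' 4 (U.pull e 4 x) = d * U.tr X 4 x := by
      simpa using LinearMap.congr_fun he x
    rw [pullC_tmul, trC_tmul, trC_tmul, h1, mul_smul]
    simp only [Rat.smul_def, smul_eq_mul]

/-- **The period of pulled-back forms along a morphism of degree `d` is `d` times the period.**  (Adapted from
IDEA-1g-Sketch §2.) [folklore] -/
theorem period_comp_of_degree (hc : U.Fact_pull_comp) (hcup : U.Fact_pull_cup) {X X' : U.Var} (e : U.Mor X' X) {d : ℚ}
    (he : U.tr X' 4 ∘ₗ U.pull e 4 = d • U.tr X 4) {Y : Fin 4 → U.Var} (F : (i : Fin 4) → U.Mor X (Y i))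
    (ω : (i : Fin 4) → U.CohC (Y i) 1) :
    U.period X' (fun i => U.pullC (U.comp e (F i)) 1 (ω i)) = (d : ℂ) • U.period X (fun i => U.pullC (F i) 1 (ω i)) := by
  simp only [Universe.period, pullC_comp_apply hc, conj_pullC, ← pullC_quadC hcup, trC_pullC_of_degree he]

/-- **Transport of `PeriodNV` along a dominant morphism of towers.**  A non-zero period on `P(V, Γ)` and a morphism
`e : P(V₂, Γ₂) → P(V, Γ)` of non-zero degree (any `(L₂, ι₂, V₂)`) give `PeriodNV` for `(ι₂, V₂)` with the same targets, forms
and eigencharacter: maps `F_i ∘ e`, period multiplied by `d ≠ 0`.  (Adapted from IDEA-1g-Sketch §2.) [folklore] -/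
theorem periodNV_of_dominant (hc : U.Fact_pull_comp) (hcup : U.Fact_pull_cup)
    {L L₂ : CMField} {ι₁ : L →+* ℂ} {ι₂ : L₂ →+* ℂ} {V : HermSpace3 L ι₁} {V₂ : HermSpace3 L₂ ι₂}
    {Γ : Level V} {Γ₂ : Level V₂} (e : U.Mor (U.pms L₂ ι₂ V₂ Γ₂) (U.pms L ι₁ V Γ)) {d : ℚ} (hd : d ≠ 0)
    (he : U.tr (U.pms L₂ ι₂ V₂ Γ₂) 4 ∘ₗ U.pull e 4 = d • U.tr (U.pms L ι₁ V Γ) 4)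
    {K : CMField} {Ψ : Fin 4 → CMType K} {σ : K →+* ℂ}
    (F : (i : Fin 4) → U.Mor (U.pms L ι₁ V Γ) (U.cmAV K (Ψ i))) (α : (i : Fin 4) → U.CohC (U.cmAV K (Ψ i)) 1)
    (hα : ∀ i, α i ∈ U.alphaLine K (Ψ i) σ) (hper : U.period (U.pms L ι₁ V Γ) (fun i => U.pullC (F i) 1 (α i)) ≠ 0) :
    U.PeriodNV ι₂ V₂ K Ψ σ := by
  refine ⟨Γ₂, fun i => U.comp e (F i), α, hα, ?_⟩
  rw [period_comp_of_degree hc hcup e he F α]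
  exact smul_ne_zero (by exact_mod_cast hd) hper

end Universe

/-! ### §2 The degree identity from injectivity in the top degree -/

namespace Model

open Literature.NumberTheory.Automorphic.PicardCM

/-- **`tr' ∘ e^* = d • tr` with `d ≠ 0`** for a morphism `e : X' ⟶ X` of smooth projective surfaces whose pull-back is
injective on `H⁴`: both `H⁴` are lines (`finrank_rat_top`), the light trace `BettiUniverse.tr` is the coordinate along a
basis vector `b`, and `d = tr'(e^* b) ≠ 0` because `e^* b ≠ 0` and `tr'` is injective (`tr_top_injective`).
[cite: VoisinHodgeI2002, §5.3.2 Thm. 5.30] -/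
theorem exists_tr_comp_pull_eq_smul {X X' : SchemeOver ℂ} (hX : IsSmoothProjective 2 X) (hX' : IsSmoothProjective 2 X')
    (e : X' ⟶ X) (hinj : Function.Injective (BettiUniverse.pull e 4)) :
    ∃ d : ℚ, d ≠ 0 ∧ BettiUniverse.tr hX' 4 ∘ₗ BettiUniverse.pull e 4 = d • BettiUniverse.tr hX 4 := by
  have h1 : Module.finrank ℚ (bettiCohomology X (2 * 2)) = 1 := finrank_rat_top hX
  set b := BettiUniverse.lineBasis hX (2 * 2) h1 with hb
  refine ⟨BettiUniverse.tr hX' 4 (BettiUniverse.pull e 4 (b 0)), ?_, ?_⟩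
  · intro h0
    have hb0 : BettiUniverse.pull e 4 (b 0) ≠ 0 := fun h ↦
      b.ne_zero 0 (hinj (h.trans (BettiUniverse.pull e 4).map_zero.symm))
    exact hb0 (tr_top_injective hX' (h0.trans (BettiUniverse.tr hX' 4).map_zero.symm))
  · apply b.ext
    intro i
    obtain rfl : i = 0 := Subsingleton.elim _ _
    have htr : BettiUniverse.tr hX (2 * 2) (b 0) = 1 := BettiUniverse.tr_lineBasis hX h1
    rw [LinearMap.comp_apply, LinearMap.smul_apply]
    change _ = _ • BettiUniverse.tr hX (2 * 2) (b 0)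
    rw [htr, smul_eq_mul, mul_one]

/-! ### §3 The ball map between the surfaces of two hermitian spaces (scheme level) -/

section Data

variable (hU : BallQuotientUniformisedDatum) (h₃ : CMAbelianVarietyRealised)
variable {L : CMField} {ι₁ : L →+* ℂ} {V V' : HermSpace3 L ι₁}

/-- **The groups of the ball data of `P(V', Γ')` and `P(V, Γ)` are conjugate-EQUAL in `GL₃(ℂ)`** when
`B Γ' B⁻¹ = Γ` in `GL₃(L)`: `γ ↦ B^{ι₁} γ (B^{ι₁})⁻¹` maps `Γ'^{τ₁}` onto `Γ^{τ₁}` (clause `datum_Γ` of both realisations; the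
two-hermitian-space, equality form of `Model.ballDatum_map_Γ_conj_le`). [folklore] -/
theorem ballDatum_map_Γ_conj_eq {Γ : Level V} {Γ' : Level V'} {γ : GL (Fin 3) L}
    (hconj : Γ'.Γ.map (MulAut.conj γ).toMonoidHom = Γ.Γ)
    (h' : (pmsCode L ι₁ V' Γ').IsAnisotropic) (h : (pmsCode L ι₁ V Γ).IsAnisotropic) :
    ((Var.ballDatum hU h₃ (pmsCode L ι₁ V' Γ') h').Γ.map
        (Matrix.GeneralLinearGroup.map (Var.ballDatum hU h₃ (pmsCode L ι₁ V' Γ') h').τ₁)).map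
        (MulAut.conj (Matrix.GeneralLinearGroup.map ι₁ γ)).toMonoidHom =
      (Var.ballDatum hU h₃ (pmsCode L ι₁ V Γ) h).Γ.map
        (Matrix.GeneralLinearGroup.map (Var.ballDatum hU h₃ (pmsCode L ι₁ V Γ) h).τ₁) := by
  change (((pmsRealisation hU _).datum h').Γ.map
      (Matrix.GeneralLinearGroup.map ((pmsRealisation hU _).datum h').E.subtype)).map _ =
    ((pmsRealisation hU _).datum h).Γ.map
      (Matrix.GeneralLinearGroup.map ((pmsRealisation hU _).datum h).E.subtype)
  rw [(pmsRealisation hU (pmsCode L ι₁ V' Γ')).datum_Γ h', (pmsRealisation hU (pmsCode L ι₁ V Γ)).datum_Γ h]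
  change ((Γ'.Γ.map (Matrix.GeneralLinearGroup.map ι₁.rangeRestrictFieldEquiv.toRingHom)).map
      (Matrix.GeneralLinearGroup.map ι₁.fieldRange.subtype)).map _ =
    (Γ.Γ.map (Matrix.GeneralLinearGroup.map ι₁.rangeRestrictFieldEquiv.toRingHom)).map
      (Matrix.GeneralLinearGroup.map ι₁.fieldRange.subtype)
  have hΦ : ∀ δ : GL (Fin 3) L,
      Matrix.GeneralLinearGroup.map (ι₁.fieldRange.subtype : ι₁.fieldRange →+* ℂ)
          (Matrix.GeneralLinearGroup.map ι₁.rangeRestrictFieldEquiv.toRingHom δ) =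
        Matrix.GeneralLinearGroup.map ι₁ δ := fun δ ↦ by
    ext i j
    rfl
  have hcomm :
      (MulAut.conj (Matrix.GeneralLinearGroup.map ι₁ γ)).toMonoidHom.comp
          ((Matrix.GeneralLinearGroup.map (ι₁.fieldRange.subtype : ι₁.fieldRange →+* ℂ)).comp
            (Matrix.GeneralLinearGroup.map ι₁.rangeRestrictFieldEquiv.toRingHom)) =
        ((Matrix.GeneralLinearGroup.map (ι₁.fieldRange.subtype : ι₁.fieldRange →+* ℂ)).comp
          (Matrix.GeneralLinearGroup.map ι₁.rangeRestrictFieldEquiv.toRingHom)).comp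
          (MulAut.conj γ).toMonoidHom := by
    ext δ : 1
    simp only [MonoidHom.comp_apply, MulEquiv.coe_toMonoidHom, MulAut.conj_apply, map_mul, map_inv, hΦ]
  calc ((Γ'.Γ.map (Matrix.GeneralLinearGroup.map ι₁.rangeRestrictFieldEquiv.toRingHom)).map
          (Matrix.GeneralLinearGroup.map ι₁.fieldRange.subtype)).map
          (MulAut.conj (Matrix.GeneralLinearGroup.map ι₁ γ)).toMonoidHom
      = (Γ'.Γ.map (MulAut.conj γ).toMonoidHom).map
          ((Matrix.GeneralLinearGroup.map (ι₁.fieldRange.subtype : ι₁.fieldRange →+* ℂ)).comp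
            (Matrix.GeneralLinearGroup.map ι₁.rangeRestrictFieldEquiv.toRingHom)) := by
        simp only [Subgroup.map_map, hcomm]
    _ = Γ.Γ.map ((Matrix.GeneralLinearGroup.map (ι₁.fieldRange.subtype : ι₁.fieldRange →+* ℂ)).comp
            (Matrix.GeneralLinearGroup.map ι₁.rangeRestrictFieldEquiv.toRingHom)) := by rw [hconj]
    _ = (Γ.Γ.map (Matrix.GeneralLinearGroup.map ι₁.rangeRestrictFieldEquiv.toRingHom)).map
          (Matrix.GeneralLinearGroup.map ι₁.fieldRange.subtype) := (Subgroup.map_map _ _ _).symm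

/-- The complex Gram matrix of `V'` is the transported one: `ι₁(V'.Hm) = (B^{ι₁})ᴴ · (ι₁ a • ι₁(V.Hm)) · B^{ι₁}`
(`ι₁ ∘ c̄ = conj ∘ ι₁`). [folklore] -/
theorem map_ι₁_of_formCongr {B : GL (Fin 3) L} {a : L} (h : formCongr (cmConjRingHom L) B (a • V.Hm) = V'.Hm) :
    V'.Hm.map ι₁ = ((Matrix.GeneralLinearGroup.map ι₁ B : GL (Fin 3) ℂ) : Matrix (Fin 3) (Fin 3) ℂ)ᴴ *
      (ι₁ a • V.Hm.map ι₁) * ((Matrix.GeneralLinearGroup.map ι₁ B : GL (Fin 3) ℂ) : Matrix (Fin 3) (Fin 3) ℂ) := by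
  rw [← h, formCongr_map (cmConjRingHom L) ι₁ (embedding_cmConjRingHom L ι₁) B (a • V.Hm)]
  have hsmul : (a • V.Hm).map ι₁ = ι₁ a • V.Hm.map ι₁ := by
    ext i j
    simp [Matrix.map_apply, Matrix.smul_apply, map_mul, smul_eq_mul]
  rw [formCongr, hsmul]
  rfl

/-- **The transport morphism between the realising schemes** (anisotropic regime): for Landherr data `(a, B)` with
`ᵗ(c̄B) · (a • V.Hm) · B = V'.Hm`, `a` totally positive, and a level `Γ` of `V`, there is a morphism
`e : P(V', Γ.transport B …) ⟶ P(V, Γ)` over `[v] ↦ [√ι₁(a) · B^{ι₁} v]` whose pull-back on `Hⁱ(−(ℂ); ℚ)` is bijective in every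
degree (Literature `UnitaryBallIsometricQuotients.exists_hom_bettiCohomology_bijective`, with `Arapura2012_Cor_15_4_6` discharged
by the tree theorem and the Hodge models `BettiUniverse.realHodgeModel hHD`).
[cite: Shimura1973, §7.2–7.3] [cite: Arapura2012, §15.4 Cor. 15.4.6] -/
theorem exists_hom_pms_transport (hHD : exists_isReal_hodgeModel) (Γ : Level V) (B : GL (Fin 3) L) {a : L}
    (ha : cmConjRingHom L a = a) (hapos : 0 < (ι₁ a).re) (ha0 : a ≠ 0)
    (h : formCongr (cmConjRingHom L) B (a • V.Hm) = V'.Hm)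
    (h' : (pmsCode L ι₁ V' (Γ.transport B ha0 h)).IsAnisotropic) (hV : (pmsCode L ι₁ V Γ).IsAnisotropic) :
    ∃ e : Var.scheme hU h₃ (.pms (pmsCode L ι₁ V' (Γ.transport B ha0 h))) ⟶ Var.scheme hU h₃ (.pms (pmsCode L ι₁ V Γ)),
      ∀ i : ℕ, Function.Bijective (bettiCohomology.map e i).hom := by
  -- the scalar `r = √ι₁(a)`: real, non-zero, `r̄ r = ι₁ a`
  set r : ℝ := Real.sqrt (ι₁ a).re with hr
  have hr0 : (r : ℂ) ≠ 0 := by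
    rw [Ne, Complex.ofReal_eq_zero, hr, Real.sqrt_eq_zero']
    exact not_le.mpr hapos
  have hreal : ((ι₁ a).re : ℂ) = ι₁ a := by
    apply Complex.conj_eq_iff_re.mp
    rw [← embedding_cmConjRingHom L ι₁ a, ha]
  have hrr : star (r : ℂ) * (r : ℂ) = ι₁ a := by
    rw [Complex.star_def, Complex.conj_ofReal, ← Complex.ofReal_mul, hr, Real.mul_self_sqrt hapos.le, hreal]
  have hrr' : (r : ℂ) * star (r : ℂ) = ι₁ a := by rw [mul_comm, hrr]
  -- the isometry `g = r · B^{ι₁}` as an invertible matrix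
  set Bι : GL (Fin 3) ℂ := Matrix.GeneralLinearGroup.map ι₁ B with hBι
  let g : GL (Fin 3) ℂ :=
    ⟨(r : ℂ) • (Bι : Matrix (Fin 3) (Fin 3) ℂ), (r : ℂ)⁻¹ • ((Bι⁻¹ : GL (Fin 3) ℂ) : Matrix (Fin 3) (Fin 3) ℂ),
      by rw [smul_mul_smul_comm, mul_inv_cancel₀ hr0, one_smul, Units.mul_inv],
      by rw [smul_mul_smul_comm, inv_mul_cancel₀ hr0, one_smul, Units.inv_mul]⟩
  have hgval : (g : Matrix (Fin 3) (Fin 3) ℂ) = (r : ℂ) • (Bι : Matrix (Fin 3) (Fin 3) ℂ) := rfl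
  -- conjugation by `g` is conjugation by `B^{ι₁}`
  have hconjg : (MulAut.conj g).toMonoidHom = (MulAut.conj Bι).toMonoidHom := by
    ext x : 1
    apply Units.ext
    show (r : ℂ) • (Bι : Matrix (Fin 3) (Fin 3) ℂ) * (x : Matrix (Fin 3) (Fin 3) ℂ) *
        ((r : ℂ)⁻¹ • ((Bι⁻¹ : GL (Fin 3) ℂ) : Matrix (Fin 3) (Fin 3) ℂ)) =
      (Bι : Matrix (Fin 3) (Fin 3) ℂ) * (x : Matrix (Fin 3) (Fin 3) ℂ) * ((Bι⁻¹ : GL (Fin 3) ℂ) : Matrix (Fin 3) (Fin 3) ℂ)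
    rw [smul_mul_assoc, smul_mul_assoc, mul_smul_comm, smul_smul, mul_inv_cancel₀ hr0, one_smul]
  -- set up the two ball data
  set D := Var.ballDatum hU h₃ (pmsCode L ι₁ V Γ) hV with hD
  set D' := Var.ballDatum hU h₃ (pmsCode L ι₁ V' (Γ.transport B ha0 h)) h' with hD'
  -- isometry clause `gᴴ · H^{τ₁}(V) · g = H^{τ₁}(V')`
  have hg : (g : Matrix (Fin 3) (Fin 3) ℂ)ᴴ * D.Hℂ * (g : Matrix (Fin 3) (Fin 3) ℂ) = D'.Hℂ := by
    have e1 : (g : Matrix (Fin 3) (Fin 3) ℂ)ᴴ * V.Hm.map ι₁ * (g : Matrix (Fin 3) (Fin 3) ℂ) =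
        ι₁ a • ((Bι : Matrix (Fin 3) (Fin 3) ℂ)ᴴ * V.Hm.map ι₁ * (Bι : Matrix (Fin 3) (Fin 3) ℂ)) := by
      rw [hgval, Matrix.conjTranspose_smul]
      simp only [Matrix.smul_mul, Matrix.mul_smul, smul_smul]
      first
      | rw [hrr]
      | rw [hrr']
    have e2 : V'.Hm.map ι₁ = ι₁ a • ((Bι : Matrix (Fin 3) (Fin 3) ℂ)ᴴ * V.Hm.map ι₁ * (Bι : Matrix (Fin 3) (Fin 3) ℂ)) := by
      rw [map_ι₁_of_formCongr h, hBι]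
      simp only [Matrix.smul_mul, Matrix.mul_smul]
    rw [hD, hD', ballDatum_Hℂ hU h₃ Γ hV, ballDatum_Hℂ hU h₃ (Γ.transport B ha0 h) h', e1, e2]
  -- conjugate-equal groups
  have hΓ : (D'.Γ.map (Matrix.GeneralLinearGroup.map D'.τ₁)).map (MulAut.conj g).toMonoidHom =
      D.Γ.map (Matrix.GeneralLinearGroup.map D.τ₁) := by
    rw [hconjg, hBι, hD, hD']
    exact ballDatum_map_Γ_conj_eq hU h₃ (Level.map_conj_transport_Γ Γ B ha0 h) h' hV
  obtain ⟨e, -, he⟩ := UnitaryBallIsometricQuotients.exists_hom_bettiCohomology_bijective arapura2012_cor_15_4_6_holds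
    ⟨BettiUniverse.realHodgeModel hHD (Var.isSmoothProjective hU h₃ (.pms (pmsCode L ι₁ V' (Γ.transport B ha0 h))))⟩
    ⟨BettiUniverse.realHodgeModel hHD (Var.isSmoothProjective hU h₃ (.pms (pmsCode L ι₁ V Γ)))⟩ hg hΓ
  exact ⟨e, he⟩

end Data

/-! ### §4 On the universe `universeOf` and on the universe of record `picardCMUniverse` -/

section Universe

variable (hHD : exists_isReal_hodgeModel) (hI : hodgePQ_independent_of_hodgeModel)
  (hU : BallQuotientUniformisedDatum) (h₃ : CMAbelianVarietyRealised)

/-- **Row A (`TowerDominance`) of IDEA-1g on `universeOf`, for `[L:ℚ] > 2`**: any two hermitian 3-spaces `V V'` over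
`(L, ι₁)` and any level `Γ` of `V` admit a level `Γ'` of `V'` and a morphism `e : U.Mor (U.pms L ι₁ V' Γ') (U.pms L ι₁ V Γ)`
with `U.tr _ 4 ∘ₗ U.pull e 4 = d • U.tr _ 4`, `d ≠ 0`. [cite: Shimura1973, §7.2–7.3] -/
theorem universeOf_towerDominance_of_two_lt {L : CMField} (hL : 2 < Module.finrank ℚ L) {ι₁ : L →+* ℂ}
    (V V' : HermSpace3 L ι₁) (Γ : Level V) :
    ∃ (Γ' : Level V') (e : (universeOf hHD hI hU h₃).Mor ((universeOf hHD hI hU h₃).pms L ι₁ V' Γ')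
        ((universeOf hHD hI hU h₃).pms L ι₁ V Γ)) (d : ℚ), d ≠ 0 ∧
      (universeOf hHD hI hU h₃).tr ((universeOf hHD hI hU h₃).pms L ι₁ V' Γ') 4 ∘ₗ (universeOf hHD hI hU h₃).pull e 4 =
        d • (universeOf hHD hI hU h₃).tr ((universeOf hHD hI hU h₃).pms L ι₁ V Γ) 4 := by
  obtain ⟨a, ha, hapos, B, hB⟩ := HermSpace3.similar V V'
  have ha0 : a ≠ 0 := fun h0 ↦ (lt_irrefl (0 : ℝ)) (by simpa [h0] using hapos ι₁)
  obtain ⟨e, he⟩ := exists_hom_pms_transport hU h₃ hHD Γ B ha (hapos ι₁) ha0 hB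
    (isAnisotropic_pmsCode_of_two_lt hL _) (isAnisotropic_pmsCode_of_two_lt hL Γ)
  obtain ⟨d, hd, hde⟩ := exists_tr_comp_pull_eq_smul
    (Var.isSmoothProjective hU h₃ (.pms (pmsCode L ι₁ V Γ)))
    (Var.isSmoothProjective hU h₃ (.pms (pmsCode L ι₁ V' (Γ.transport B ha0 hB)))) e (he 4).1
  exact ⟨Γ.transport B ha0 hB, e, d, hd, hde⟩

/-- **`PeriodNV` does not depend on the hermitian space** (`universeOf`, `[L:ℚ] > 2`): a non-zero face/PerL period on some
surface of the `V`-tower gives one on a surface of the `V'`-tower, with the same targets, forms and eigencharacter.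
[cite: Shimura1973, §7.2–7.3] -/
theorem universeOf_periodNV_transport {L : CMField} (hL : 2 < Module.finrank ℚ L) {ι₁ : L →+* ℂ} {V : HermSpace3 L ι₁}
    (V' : HermSpace3 L ι₁) {K : CMField} {Ψ : Fin 4 → CMType K} {σ : K →+* ℂ}
    (hV : (universeOf hHD hI hU h₃).PeriodNV ι₁ V K Ψ σ) : (universeOf hHD hI hU h₃).PeriodNV ι₁ V' K Ψ σ := by
  obtain ⟨Γ, F, α, hα, hper⟩ := hV
  obtain ⟨Γ', e, d, hd, he⟩ := universeOf_towerDominance_of_two_lt hHD hI hU h₃ hL V V' Γ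
  exact Universe.periodNV_of_dominant (universeOf_fact_pull_comp hHD hI hU h₃) (universeOf_fact_pull_cup hHD hI hU h₃)
    e hd he F α hα hper

/-- **`PerL ⇒ PerL44` on `universeOf`**: the node statement `W_per^L` (`∃ (V₃,h)`) implies PerL Thm 4.4 as proved
(`∀ (V₃,h)`), the surface field `L = K̃` having degree `24` or `48`. [cite: Shimura1973, §7.2–7.3] -/
theorem universeOf_perL44_of_perL (h : (universeOf hHD hI hU h₃).PerL) : (universeOf hHD hI hU h₃).PerL44 := by
  intro K L j hN h6 h24 φ hφ ι₁ hι t ht V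
  obtain ⟨V₀, hV₀⟩ := h K L j hN h6 h24 φ hφ ι₁ hι t ht
  have hL : 2 < Module.finrank ℚ L := by rcases h24 with h | h <;> omega
  exact universeOf_periodNV_transport hHD hI hU h₃ hL V hV₀

/-- **The face period theorem on `universeOf` is equivalent to its `∃ V`-form**: one hermitian space per `(F, f, ι₁)`
suffices (`←`: transport, `[F:ℚ] ≥ 6`; `→`: `LandherrExists`). [cite: Shimura1973, §7.2–7.3] -/
theorem universeOf_periodThmF_iff_exists :
    (universeOf hHD hI hU h₃).PeriodThmF ↔
      ∀ (F : CMField), IsGalois ℚ F → 6 ≤ Module.finrank ℚ F →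
        ∀ (f : Face F) (ι₁ : F →+* ℂ), f.Admissible ι₁ →
          ∃ V : HermSpace3 F ι₁, (universeOf hHD hI hU h₃).PeriodNV ι₁ V F f.psi ι₁ := by
  constructor
  · intro h F hG h6 f ι₁ hι
    obtain ⟨V⟩ := landherr_exists_proof F ι₁
    exact ⟨V, h F hG h6 f ι₁ hι V⟩
  · intro h F hG h6 f ι₁ hι V
    obtain ⟨V₀, hV₀⟩ := h F hG h6 f ι₁ hι
    exact universeOf_periodNV_transport hHD hI hU h₃ (by omega) V hV₀

end Universe

section EndState

variable (hHD : exists_isReal_hodgeModel) (hI : hodgePQ_independent_of_hodgeModel)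
  (h₁ : BallQuotientUniformised) (h₃ : CMAbelianVarietyRealised)

/-- **Row A (`TowerDominance`) of IDEA-1g on the universe of record `picardCMUniverse hHD hI h₁ h₃`, for `[L:ℚ] > 2`.**
[cite: Shimura1973, §7.2–7.3] -/
theorem towerDominance_of_two_lt {L : CMField} (hL : 2 < Module.finrank ℚ L) {ι₁ : L →+* ℂ}
    (V V' : HermSpace3 L ι₁) (Γ : Level V) :
    ∃ (Γ' : Level V') (e : (picardCMUniverse hHD hI h₁ h₃).Mor ((picardCMUniverse hHD hI h₁ h₃).pms L ι₁ V' Γ')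
        ((picardCMUniverse hHD hI h₁ h₃).pms L ι₁ V Γ)) (d : ℚ), d ≠ 0 ∧
      (picardCMUniverse hHD hI h₁ h₃).tr ((picardCMUniverse hHD hI h₁ h₃).pms L ι₁ V' Γ') 4 ∘ₗ
          (picardCMUniverse hHD hI h₁ h₃).pull e 4 =
        d • (picardCMUniverse hHD hI h₁ h₃).tr ((picardCMUniverse hHD hI h₁ h₃).pms L ι₁ V Γ) 4 :=
  universeOf_towerDominance_of_two_lt hHD hI (ballQuotientUniformisedDatum_of h₁) h₃ hL V V' Γ

/-- **`PeriodNV` of the universe of record does not depend on the hermitian space** (`[L:ℚ] > 2`).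
[cite: Shimura1973, §7.2–7.3] -/
theorem periodNV_transport {L : CMField} (hL : 2 < Module.finrank ℚ L) {ι₁ : L →+* ℂ} {V : HermSpace3 L ι₁}
    (V' : HermSpace3 L ι₁) {K : CMField} {Ψ : Fin 4 → CMType K} {σ : K →+* ℂ}
    (hV : (picardCMUniverse hHD hI h₁ h₃).PeriodNV ι₁ V K Ψ σ) : (picardCMUniverse hHD hI h₁ h₃).PeriodNV ι₁ V' K Ψ σ :=
  universeOf_periodNV_transport hHD hI (ballQuotientUniformisedDatum_of h₁) h₃ hL V' hV

/-- **`PerL ⇒ PerL44` on the universe of record**: `W_per^L` (the E term's conclusion shape, `∃ (V₃,h)`) implies PerL Thm 4.4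
as proved (`∀ (V₃,h)`). [cite: Shimura1973, §7.2–7.3] -/
theorem perL44_of_perL (h : (picardCMUniverse hHD hI h₁ h₃).PerL) : (picardCMUniverse hHD hI h₁ h₃).PerL44 :=
  universeOf_perL44_of_perL hHD hI (ballQuotientUniformisedDatum_of h₁) h₃ h

/-- **`PeriodThmF` of the universe of record ⇔ its `∃ V`-form.** [cite: Shimura1973, §7.2–7.3] -/
theorem periodThmF_iff_exists :
    (picardCMUniverse hHD hI h₁ h₃).PeriodThmF ↔
      ∀ (F : CMField), IsGalois ℚ F → 6 ≤ Module.finrank ℚ F →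
        ∀ (f : Face F) (ι₁ : F →+* ℂ), f.Admissible ι₁ →
          ∃ V : HermSpace3 F ι₁, (picardCMUniverse hHD hI h₁ h₃).PeriodNV ι₁ V F f.psi ι₁ :=
  universeOf_periodThmF_iff_exists hHD hI (ballQuotientUniformisedDatum_of h₁) h₃

/-- **`PerLFace` of the universe of record ⇔ its `∃ V`-form** (`PerLFace U = U.PeriodThmF`, `Interfaces.lean`): the open
junction B01's target may be met on ONE hermitian space per admissible face datum `(F, f, ι₁)`.  Not a display of record, not
an E term; the wording of record is unchanged. [cite: Shimura1973, §7.2–7.3] -/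
theorem perLFace_iff_exists :
    (picardCMUniverse hHD hI h₁ h₃).PerLFace ↔
      ∀ (F : CMField), IsGalois ℚ F → 6 ≤ Module.finrank ℚ F →
        ∀ (f : Face F) (ι₁ : F →+* ℂ), f.Admissible ι₁ →
          ∃ V : HermSpace3 F ι₁, (picardCMUniverse hHD hI h₁ h₃).PeriodNV ι₁ V F f.psi ι₁ :=
  periodThmF_iff_exists hHD hI h₁ h₃

end EndState

end Model

end Summit.HodgeConjecture.CorCM

end
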